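import Mathlib
import HarnessLib
import HarnessLib.Audit
import Summits.AtomisticToContinuum.Statement

/-!
Route: OneFlightGossip

CLOSED (retired) 2026-08-15T13:45:04Z by operator:999:1257524 — reason: not-a-thesis: assembly does not conclude the sub-problem Statement — note: D-0027 §2.1 audit (human 2026-08-15: routes that do not decide the summit are removed): the assembly concludes `Literature.MathematicalPhysics.KineticTheory.HydrodynamicLimit`, not the sub-problem statement; a NEW conforming route may be opened from the same idea (generated `closes : … → _root_.Hydr. The file is kept as the record of this route; refuted decls are indexed as negative knowledge (`ledger negatives`).

# Route OneFlightGossip — one-flight hyperbolicity (ℓ/ε ≍ σ⁻³) isotropises collision kicks given a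
coarse past; gossip + isotropic kicks give N-uniform equilibrium decorrelation of kinetic stress and
heat flux

X_OF = B1′ ∧ C3 ∧ C4 ("it suffices to show", as an ENGINE for the kinetic half of route
KineticWindows' one-block input).
B1′ (ONE-FLIGHT LAYERED ANGULAR CHAOS, informal crux filed after open, rank 2): for hard-sphere
flows on 𝕋³ at small fixed
reduced density σ started from a (local) Gibbs law, conditionally on an r-COARSE past of ALL
particles (ε ≪ r ≪ ℓ ≍ ε/σ³),
the outgoing relative directions of the next layer of collisions are jointly near-uniform on S²,
with per-collision defect
polynomially small in σ (heuristically (ε/r)² + r/ℓ, ≍ σ^{3/2} after optimising r), uniformly in N —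
the card's one-flight standard-pair lemma (expansion 1 + 2L/ε ≍ σ⁻³ per
flight, frozen environment along the unstable family) CORRECTED for shadowing by near-miss third
spheres. C3/C4 (typed
cruxes): the deliverables such kicks buy through the GOSSIP decomposition of hard-sphere kinematics
(cᵢ′ = V + ½|g|ĝ_out:
averaging + isotropic kick): under GLOBAL Gibbs data the per-particle variance of the
window-averaged kinetic SHEAR STRESS
(C3) and of the fast kinetic HEAT FLUX v¹|v|² − 5θ₀v¹ (C4) tends to 0 as the window τ (in mean free
times) → ∞, limsup in
N first — the second-cumulant shadows, at fixed density, of EquilibriumShearWindowLD /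
KineticWindowLD (route
KineticWindows, stmt-AtomisticToContinuum-3656/3654). Realises card one-flight-standard-pairs-kac
(spine).
Lean: `(∀ (a₀ θ₀ : ℝ), 0 < a₀ → 0 < θ₀ → ∃ σ₀ : ℝ, 0 < σ₀ ∧ ∀ σ : ℝ, 0 < σ → σ < σ₀ → ∀ Φ : (N : ℕ)
→ Literature.Analysis.FluidPDE.HardSphereFlow (Literature.Analysis.FluidPDE.Torus.geometry (Fin 3))
(Literature.MathematicalPhysics.KineticTheory.hsDiameter σ N) (N + 1), ∀ φ :
Literature.MathematicalPhysics.KineticTheory.T3 → ℝ, Continuous φ → Filter.Tendsto (fun τ : ℝ =>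
Filter.limsup (fun N : ℕ => ((N : ENNReal) + 1) * ∫⁻ z, ENNReal.ofReal ((((N : ℝ) + 1)⁻¹ * ∑ i : Fin
(N + 1), (τ * ((N : ℝ) + 1) ^ (-(1 / 3 : ℝ)))⁻¹ * ∫ r in (0 : ℝ)..(τ * ((N : ℝ) + 1) ^ (-(1 / 3 :
ℝ))), φ ((Φ N).flow r z i).1 * (((Φ N).flow r z i).2 0 * ((Φ N).flow r z i).2 1)) ^ 2)
∂(Literature.MathematicalPhysics.KineticTheory.localGibbsLaw σ (fun _ => a₀) (fun _ => 0) (fun _ =>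
θ₀) N (Φ N))) Filter.atTop) Filter.atTop (nhds 0)) ∧ (∀ (a₀ θ₀ : ℝ), 0 < a₀ → 0 < θ₀ → ∃ σ₀ : ℝ, 0 <
σ₀ ∧ ∀ σ : ℝ, 0 < σ → σ < σ₀ → ∀ Φ : (N : ℕ) → Literature.Analysis.FluidPDE.HardSphereFlow
(Literature.Analysis.FluidPDE.Torus.geometry (Fin 3))
(Literature.MathematicalPhysics.KineticTheory.hsDiameter σ N) (N + 1), ∀ φ :
Literature.MathematicalPhysics.KineticTheory.T3 → ℝ, Continuous φ → Filter.Tendsto (fun τ : ℝ =>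
Filter.limsup (fun N : ℕ => ((N : ENNReal) + 1) * ∫⁻ z, ENNReal.ofReal ((((N : ℝ) + 1)⁻¹ * ∑ i : Fin
(N + 1), (τ * ((N : ℝ) + 1) ^ (-(1 / 3 : ℝ)))⁻¹ * ∫ r in (0 : ℝ)..(τ * ((N : ℝ) + 1) ^ (-(1 / 3 :
ℝ))), φ ((Φ N).flow r z i).1 * (((Φ N).flow r z i).2 0 * ‖((Φ N).flow r z i).2‖ ^ 2 - 5 * θ₀ * ((Φ
N).flow r z i).2 0)) ^ 2) ∂(Literature.MathematicalPhysics.KineticTheory.localGibbsLaw σ (fun _ =>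
a₀) (fun _ => 0) (fun _ => θ₀) N (Φ N))) Filter.atTop) Filter.atTop (nhds 0))`

## Assembly
Engine route; the typed assembly is the shared one. Chain (prose): OneFlightLayeredChaos (B1′,
informal rank 2) ⇒ [pathwise
gossip decomposition c_fin = Wc + Σ W_{>t}ξ_t; GossipStressIdentity for the conditional mean; LLN
for gossip averages under
Gibbs; defect bookkeeping] ⇒ EquilibriumStressVarianceDecay, and with KacPairHeatFlux on ring-sparse
schedules ⇒
EquilibriumHeatFluxVarianceDecay; the dock item (support, filed after open: all joint cumulants
Cesàro-null + local-Gibbs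
transfer over kinetic windows) upgrades these to EquilibriumShearWindowLD (3656) and to
KineticWindowLD (3654) restricted
to the traceless-stress and fast-heat-flux functionals — the only kinetic fast currents the Euler
closure uses; route
KineticWindows (CollisionalWindowLD, EnergyCurrentTails 3655, EntropyClockReduction) then gives
RelEntropyVanishing (0766),
and 0769 (entropy inequality against exponentially concentrating local Gibbs references) gives the
conjunct.

Rationale: WHY THIS LINE. The card's mechanism: at packing φ = σ³ the free flight is ℓ ≍ ε/φ long, so ONE
flight followed by a dispersing collision
expands post-collisional direction families by ≍ φ⁻¹ (Krylov's ℓ/a amplification; Sinai fronts;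
Dorfman1999 Ch. 18), and
in d = 3 hard-sphere scattering maps a uniform impact parameter to a uniform outgoing relative
direction with CONSTANT
Jacobian ε²/4, so a Chernov–Dolgopyat standard-pair step (ChernovDolgopyat2009;
doi:10.1007/s00023-007-0351-7; programme
doi:10.4171/022-2/80) is two-body along the family — small fixed density is used as a hyperbolicity
parameter, not an
expansion parameter. Two things are new relative to the card and to every open route. (1) A
correction found while
planning: given the EXACT environment the next impact parameter is uniform only on the VISIBLE part
of the target disc —
near-miss third spheres (expected (4/3)·L/ℓ per flight, a Boltzmann–Grad-scale count independent of
φ) shadow lunes with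
probability ≥ 1 − e^{−4L/3ℓ} — so B1 must condition every particle at a resolution r ≫ ε (shadow
offsets then average by
translation invariance at scale ε), which is what B1′ states, with its price (ε/r)². (2) The
consumption device is made
exact: hard-sphere kinematics is "pairwise averaging + isotropic kick", so for an EXOGENOUS schedule
the expected traceless
second moments after the window equal those of the GOSSIP-averaged initial velocities (typed support
GossipStressIdentity;
distributed averaging, doi:10.1109/tit.2006.874516), and one collision of independent mean-zero
velocities multiplies the
pair's expected heat flux by 2/3 and splits it evenly (typed support KacPairHeatFlux; the
Ikenberry–Truesdell/Maxwell-molecule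
moment algebra doi:10.1512/iumj.1956.5.55001, Kac programme doi:10.1007/bf02392695,
doi:10.1137/070695423, Wild-sum trees
for hard spheres doi:10.1142/s0218202515500256) — stress needs ONLY angular chaos plus a law of
large numbers for gossip
averages; heat flux needs in addition factorisation of cubic cross moments at contact (the SEL half
isolated by card
angles-are-not-enough-partner-selection). Imported areas: hyperbolic billiards (growth/standard
pairs), distributed
consensus (products of averaging matrices, coalescing dual walkers), Kac's programme. Versus routes
on the ledger:
RelEntropyErgodic/ChaoticMixing ask for invariant-measure classification or n-uniform mixing RATES
of closed boxes;
KineticWindows fixes the architecture (entropy clock + finite-window LD) and explicitly leaves the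
engine unfiled; this
route is that engine for the kinetic currents, with typed equilibrium targets strictly weaker than
3656 (second cumulant)
that are its cheapest tests; BGSSCPAM2023 proves equilibrium correlation decay only in the
Boltzmann–Grad limit.

RANKED CRUXES. #0 RelEntropyVanishing (target) — Yau's relative-entropy form of the limit (shared
typed target stmt-AtomisticToContinuum-0766 of
RelEntropyErgodic/ChaoticMixing/VanishingNoise/KineticWindows): for all continuous profiles ∃ σ₀ ∀
σ<σ₀ ∀ classical hs-Euler solutions on [0,T) ∀ flow families, the local Gibbs laws are probability
measures and, if their fields converge at t=0, then ∀ t<T there is an activity profile a_t whose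
local Gibbs law (a_t,u_t,θ_t) concentrates its three empirical fields exponentially and klDiv(lawAt
Φ_N (localGibbs a₀u₀θ₀) t ‖ localGibbs a_t u_t θ_t)/(N+1) → 0. This route feeds it only through
route KineticWindows (kinetic half of KineticWindowLD). (why it might fail: entropy production ≥ cN
before the first shock for some smooth data would close every entropy route; OVY prove it only with
noise and a modified kinetic energy.) [Yau1991, OllaVaradhanYau1993, Varadhan1993EntropyMethods]
#3 EquilibriumStressVarianceDecay (crux) — EQUILIBRIUM KINETIC SHEAR-STRESS DECORRELATION, UNIFORM
IN N, AT FIXED SMALL DENSITY (card B2 made a deliverable; second-cumulant shadow of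
EquilibriumShearWindowLD stmt-3656). For constants a₀, θ₀ > 0 there is σ₀ > 0 such that for 0 < σ <
σ₀, every family of hard-sphere flows Φ_N (N+1 spheres of diameter hsDiameter σ N on 𝕋³) and every
continuous φ : 𝕋³ → ℝ: with λ^N = localGibbsLaw σ a₀ 0 θ₀ N Φ_N (canonical Gibbs, flow-invariant),
w_N = τ(N+1)^{-1/3} (τ mean-free-time units) and Ȳ_τ(z) = (N+1)⁻¹ Σ_i w_N⁻¹ ∫₀^{w_N} φ(x_i(r))
v_i¹(r) v_i²(r) dr along Φ_N.flow r z: lim_{τ→∞} limsup_{N→∞} (N+1)·E_{λ^N}[Ȳ_τ²] = 0. Equivalently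
the per-particle time-autocorrelation of the φ-weighted kinetic shear stress is Cesàro-null on
kinetic time scales uniformly in N ("no O(1) elastic memory at Euler scaling"); hydrodynamic
fluctuation theory predicts (N+1)E[Ȳ_τ²] ≍ θ₀²⟨φ²⟩(c₁ + c₂ log τ)/τ (long-time tails are integrable
in d=3). Engine: B1′ ⇒ kicks conditionally isotropic ⇒ E[stress(t) | coarse 𝒢₀] = traceless stress
of gossip-averaged velocities + defects (GossipStressIdentity pathwise form) ⇒ Cov(stress(0),
stress(t)) ≤ E|T(0)|·(‖gossip average‖² + Σ defects), gossip averages small by LLN under Gibbs.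
[deps: GossipStressIdentity] [difficulty: open-problem] (why it might fail: at fixed σ the
one-flight defects ((ε/r)² near-miss conditioning, r/ℓ distortion) may not decay along layers — a
perturbative Cesàro floor O(σ^{3/4}) instead of 0; removing it needs an N-uniform self-improving
(coupling) step unknown even for one 3-D particle beyond finite horizon.) [BGSSCPAM2023,
ChernovDolgopyat2009, doi:10.4171/022-2/80, BalintToth2008, doi:10.1109/tit.2006.874516,
Dorfman1999]
#4 EquilibriumHeatFluxVarianceDecay (crux) — EQUILIBRIUM KINETIC HEAT-FLUX DECORRELATION, UNIFORM IN
N (card B2, cubic moment). Same setting as EquilibriumStressVarianceDecay with the FAST part of the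
kinetic energy current, F(x,v) = φ(x)(v¹|v|² − 5θ₀v¹) (v¹|v|² minus its L²(M_{0,θ₀}) projection
5θ₀v¹ onto the collision invariant v¹; mean zero and orthogonal to 1, v, |v|² under the centred
Maxwellian): lim_{τ→∞} limsup_N (N+1)·E_{λ^N}[Ȳ_τ²] = 0. Engine: on ring-sparse (tree) schedules
with independent mean-zero inputs the per-particle expected heat-flux vector follows the 2/3-DAMPED
gossip q ↦ (2/3)·A_{ij}q (KacPairHeatFlux + induction), so ‖q‖₁ contracts by (2/3)^m over m rounds
in which every particle collides; at equilibrium partner velocities are independent at time 0 and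
ring collisions are O(σ³)-rare per flight. [deps: KacPairHeatFlux, EquilibriumStressVarianceDecay]
[difficulty: open-problem] (why it might fail: cubic observable: the damped gossip needs
factorisation of cubic CROSS moments of colliding partners (partner-selection half of chaos, not
supplied by angles) and velocity tails; persistence gives only 2/3 per collision and late-arriving
mass escapes damping on non-round schedules.) [doi:10.1512/iumj.1956.5.55001,
doi:10.1007/bf02392695, doi:10.1137/070695423, doi:10.1142/s0218202515500256, Lutsko1996,
BGSSCPAM2023]
#9 GossipStressIdentity (support) — EXACT GOSSIP CLOSURE OF TRACELESS SECOND MOMENTS (card B2,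
exogenous schedule; provable now). For n velocities c : Fin n → ℝ³, a schedule s : Fin m → Fin n ×
Fin n of pairs (i_t ≠ j_t) and independent kicks ω_t ∼ ν_t with ν_t probability measures on ℝ³
carried by the unit sphere, mean zero and isotropic second moments (∫⟪ω,e⟫² dν_t = |e|²/3): running
the Kac/hard-sphere kinematics c ↦ (c_i, c_j ← ½(c_i+c_j) ± ½|c_i−c_j| ω_t) along s, the expectation
of Σ_k (⟪c_k,e⟫² − |c_k|²|e|²/3) after the schedule equals the same traceless quadratic form
evaluated at the GOSSIP-averaged velocities (c_i, c_j ← ½(c_i+c_j) along s, no kicks), for every e.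
One step: ∫[⟪V±hω,e⟫² − |V±hω|²|e|²/3]dν = ⟪V,e⟫² − |V|²|e|²/3; then induction over the fold +
Fubini on Measure.pi. Consequence used by the cruxes: T_after = Σ_k ((Wc)_k)^{⊗2}° with W the
product of averaging matrices, and Σ_k W_{ka}² = meeting probability of two schedule-driven lazy
walkers from a (coalescing-dual bound: ≤ 2^{−#collisions of the host} + P(hosts re-collide)).
[difficulty: provable-now] [doi:10.1109/tit.2006.874516, doi:10.1007/bf02392695,
ChernovDolgopyat2009]
#9 KacPairHeatFlux (support) — ONE KAC COLLISION DAMPS THE PAIR HEAT FLUX BY 2/3 AND SPLITS IT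
EVENLY (card B2, cubic; provable now). For independent ℝ³-valued velocities x ∼ μ, y ∼ μ′
(probability laws with finite third moments and mean zero) and an independent kick ω ∼ ν
(probability law on the unit sphere, symmetric under ω ↦ −ω, isotropic second moments), the
post-collisional velocity x′ = ½(x+y) + ½|x−y|ω satisfies E[⟪x′,e⟫|x′|²] = (E[⟪x,e⟫|x|²] +
E[⟪y,e⟫|y|²])/3 for every e (and the same for y′ = ½(x+y) − ½|x−y|ω by symmetry of ν). Proof:
E_ω[⟪V+hω,e⟫|V+hω|²] = ⟪V,e⟫(|V|² + (5/3)h²) (odd moments of ω vanish, E⟪ω,e⟫⟪ω,V⟫ = ⟪e,V⟫/3), then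
E⟪V,e⟫|V|² = E⟪V,e⟫h² = (q_x+q_y)/8 by independence and zero means. Iterated along a tree schedule
this is the (2/3)-damped gossip of EquilibriumHeatFluxVarianceDecay. [difficulty: provable-now]
[doi:10.1512/iumj.1956.5.55001, doi:10.1007/bf02392695, doi:10.1142/s0218202515500256]
#9 EquilibriumShearWindowLD (support) — (shared with route KineticWindows,
stmt-AtomisticToContinuum-3656, where it is the cheapest typed special case of KineticWindowLD)
scale-N exponential moments of the window-averaged kinetic shear stress under GLOBAL Gibbs data are
exp(o(N)) on a β-disc for one window per tolerance. This route is an engine for it: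
EquilibriumStressVarianceDecay is its second-cumulant content; the all-cumulant upgrade is the dock
item filed after open. [difficulty: open-problem] [BGSSCPAM2023, BodineauEtAl2024, LeBihan2022,
OllaVaradhanYau1993]

TWO-LAYER PLAN. Foreseen glued splits (k ≤ 3, depth 1), nothing filed now:
EquilibriumStressVarianceDecay ⇐ EquilibriumLayeredChaos (B1′ for
global Gibbs data over m layers, defects summable in m) → EndogenousGossipConsumption (pathwise
T_fin = Σ_k((Wc)_k)^{⊗2}° +
2·Sym Σ_k (Wc)_k ⊗ (c_fin − Wc)_k + Σ_k (M_k)^{⊗2}°, Cauchy–Schwarz for the cross term, conditional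
isotropy for the
diagonal, LLN for ‖Wc‖ under Gibbs) → EquilibriumStressVarianceDecay.
EquilibriumHeatFluxVarianceDecay ⇐ TreeDampedGossip
((2/3)^m on m-round ring-sparse schedules, induction on KacPairHeatFlux) → ContactCubicFactorisation
(cubic cross moments of
colliding partners factorise at equilibrium over finite windows, rings O(σ³)) →
EquilibriumHeatFluxVarianceDecay.
OneFlightLayeredChaos ⇐ TwoBodyFlightLemma (geometry: a log-Lipschitz direction density at angular
scale ≫ ε/L induces, on
the rays reaching a ball of radius ε at distance L first, the uniform law on the VISIBLE region up
to O(ε/L); provable now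
once collision records exist) → NearMissAveraging (coarse conditioning averages shadows; price
(ε/r)²) → OneFlightLayeredChaos.

KILL CRITERIA. ¬EquilibriumStressVarianceDecay (a fixed small σ at which the per-particle kinetic
shear-stress autocorrelation keeps a
positive Cesàro mean uniformly in N — O(1) elastic memory at Euler scaling) closes this route
outright (close --reason
refuted:EquilibriumStressVarianceDecay) AND refutes EquilibriumShearWindowLD, i.e. breaks route
KineticWindows' kinetic line
and card stationary-shear-rung. ¬EquilibriumHeatFluxVarianceDecay with C3 standing ⇒ pivot: the
engine is stress-only
(rung 1, stationary shear data), heat flux handed to the SEL crux E4 of card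
angles-are-not-enough-partner-selection.
¬OneFlightLayeredChaos in the form "the conditional law of the next impact parameter given an
r-coarse past keeps total-
variation defect ≥ c > 0 at arbitrarily small σ for every r" kills the MECHANISM (close
refuted:OneFlightLayeredChaos) but
not C3/C4, which stay wanted by KineticWindows-type routes. GibbsErgodicity (0779) or
KineticWindowLD (3654) proved elsewhere
moots C3/C4; a refutation of GossipStressIdentity/KacPairHeatFlux would mean a slip in this file's
algebra (checked by hand:
one-step identities ⟪V,e⟫² − |V|²|e|²/3 and (q_x+q_y)/3), report to the tenure planner.

NOT DECOMPOSED YET. The coarse filtration / collision-record formalism for B1′ (definition request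
below); the d = 2, N = 2 sanity bench of
the card (B5: two discs on 𝕋², conditional equidistribution of the k-th impact parameter — needs the
same API; note that
in d = 2 the kick is NOT mean-zero along ĝ, persistence κ = ∫cos χ); equilibrium ring/corner events
over finite windows
(inside B1′); the endogenous-schedule coupling ("future schedule isotropic in the kick to first
order"); local-Gibbs
(non-constant profile) versions of C3/C4 and the all-cumulant upgrade (dock item); collisional
transfer and tails (route
KineticWindows: CollisionalWindowLD, 3655); the m-step tree version of KacPairHeatFlux (routine
induction, provers attach
it with --supports). All wait for B1′ to be grounded or C3 to move.

CHEAPEST FALSIFIER. Mechanism: an event-driven MD run (kit, when allowed) of EQUILIBRIUM hard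
spheres, N ∈ {10⁴, 10⁵}, σ³ ∈ {0.01, 0.05, 0.1}:
(a) histogram of b²/ε² of real collisions conditional on the EXACT pre-flight environment class "a
third sphere centre
within ε(1+L′/L) of the flight line" — B1-as-carded predicts uniform, the shadow analysis predicts a
lune deficit of
relative size O(1) (this decides card B1 vs B1′ in an afternoon); (b) the same histogram conditional
only on r-coarse
data, defect vs r: predicted (ε/r)² + r/ℓ with minimum ≍ σ^{3/2}; (c) (N+1)·E[Ȳ_τ²] for the shear
stress vs τ ∈ [1,64]:
must fall like (c₁ + c₂ log τ)/τ, N-independently. Lookup falsifier (run: crossref/galaxy/frontier,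
nothing found): a
theorem giving N-uniform Cesàro decay of equilibrium stress autocorrelations at FIXED small density
would make C3 `known`
(nearest: BGSSCPAM2023, Boltzmann–Grad only). Lean falsifier: the two support identities are finite
computations — a
counterexample to either kills the consumption device (hand-checked true).

NUMBERS. Mean free path ℓ = 1/(√2·π n ε²), so ℓ/ε = 1/(√2 π σ³): 22.5 at σ³ = 0.01, 4.5 at σ³ =
0.05, 2.25 at σ³ = 0.1; per-flight
expansion of direction families 1 + 2L/ε. Near-miss partial shadowers per flight of length L:
(4/3)·L/ℓ (tube of radius
2ε holds 4× the collision tube: Boltzmann–Grad-scale, φ-independent); P(no shadow) = e^{−4L/3ℓ} ≈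
0.26 at L = ℓ. Gossip
contraction of traceless stress per collision of a fresh pair: 1/2; heat flux: 2/3 (KacPairHeatFlux;
cf. Prandtl number
2/3 and the Ikenberry–Truesdell Maxwell-molecule eigenvalue ordering); Chapman–Cowling mean
persistence ratio 0.406.
Heuristic scale optimisation (part of B1′, not a theorem): r ≍ (εℓ)^{1/2} ⇒ per-collision defect ≍
(ε/ℓ)^{1/2} ≍ 2.1·σ^{3/2}; the perturbative Cesàro floor for C3 would then be ≍ σ^{3/4}. Items at
open: 7 typed (2 cruxes,
3 support, shared target + assembly) + 2 informal filed after open.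

DEFINITION REQUESTS. (1) HardSphereCollisionRecord (topic Literature/Analysis/FluidPDE, for B1′ and
the card's B5 bench; shared need with card
limit-collision-measure-chaos): for γ with IsHardSphereTrajectory G ε N γ, the ordered collision
times of particle i in
[a,b] (finite by locFinite), the partner j, the contact normal ω = sepVec/ε, incoming velocities
(left limits, `binary`
field) and outgoing relative direction ĝ_out; plus the empirical collision sum Σ_{collisions in
[a,b]} F(record) as a
function of the initial point of a HardSphereFlow (KineticWindows wants the same `collisionSum`).
(2) No new Literature
facts are requested: Simányi's ergodicity
(`Literature.MathematicalPhysics.KineticTheory.simanyi_hardBall_ergodic`) is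
NOT used (finite-N ergodicity gives no N-uniformity); Mathlib's condExp/Measure.pi/intervalIntegral
suffice for the typed items.

Novelty: Searches (2026-08-15): `lit search --source crossref` ×8 ("randomized gossip algorithms Boyd Ghosh
Prabhakar Shah" → doi:10.1109/tit.2006.874516; "products of stochastic matrices averaging" →
doi:10.1007/978-3-642-28003-0_2; "Maxwell molecules moments relaxation heat flux Ikenberry
Truesdell" → doi:10.1512/iumj.1956.5.55001, doi:10.1063/1.1706082; "stress autocorrelation hard
sphere gas low density rigorous" → doi:10.1002/cpa.22120 = BGSSCPAM2023, Eder 1977, Résibois 1975;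
"Chernov Dolgopyat standard pairs many particle" → doi:10.4171/022-2/80,
doi:10.1007/s00220-011-1342-6; "energy transfer billiard gas Dolgopyat Liverani" →
doi:10.1007/s00220-011-1317-7; "Enskog collision statistics empirical Pulvirenti Simonella" →
doi:10.1007/s00222-016-0682-4, doi:10.1142/s0218202515500256; "molecular chaos impact parameter
shadowing third particle" → nothing relevant); `lit frontier AtomisticToContinuum --since 2021` (30
rows: CanestrariLiveraniOlla2026, DHM follow-ups, binary-collision-model fluctuations
doi:10.1007/s10955-026-03570-w — none on standard pairs for gases); `lit bridges
AtomisticToContinuum --cross any` (30 rows, survey doi:10.1090/bull/1650 only); `lit galaxy search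
"standard pairs hard spheres gas equidistribution impact parameter" --star all` (0 rows; crabby
queue timed out); local `lit search`/OpenAlex unavailable this session (searchd reset / 429).
Ledger: 10 route files of the sub read (none uses standard pairs, gossip or Kac consumption;
KineticWindows leaves its e  [refs: 10.1109/tit.2006.874516, 10.1007/978-3-642-28003-0_2, 10.1512/iumj.1956.5.55001, 10.1063/1.1706082, 10.1002/cpa.22120, 10.4171/022-2/80, 10.1007/s00220-011-1342-6, 10.1007/s00220-011-1317-7, 10.1007/s00222-016-0682-4, 10.1142/s0218202515500256, 10.1007/s10955-026-03570-w, 10.1090/bull/1650, 10.1090/memo/0927, 10.1007/s00023-007-0351-7, 10.1007/bf02392695, 10.1137/070695423, doi:10.1109/tit.2006.87]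

Barriers (technique_class: standard-pairs hyperbolic-coupling kac-walk gossip): - technique_class: standard-pairs hyperbolic-coupling kac-walk gossip
- Literature.Barriers.AtomisticToContinuum.BoltzmannHypothesisBarrier: evaded in form — no
classification of stationary states of the infinite system is attempted; the engine proves
finite-window decorrelation from explicit (local) Gibbs data, uniformly in N, and the barrier's
ideal-gas kernel is respected exactly (no collisions ⇒ every averaging matrix is the identity ⇒
GossipStressIdentity gives no decay and C3 is false for free flight, as it must be).
- Literature.Barriers.AtomisticToContinuum.MacroErgodicityBarrier: the FouriersLaw-side sibling
(regular stationary states of chains); not met — Euler scale, finite windows, no sector condition;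
the bet is that conditional MEANS over kinetic windows (gossip) replace ergodic decompositions.
- Literature.Barriers.AtomisticToContinuum.HighMomentumCutoffBarrier: touches
EquilibriumHeatFluxVarianceDecay (cubic growth) and the dock; not evaded here — at equilibrium
Gaussian moments make C4 finite, and before shocks the tail input is route KineticWindows'
EnergyCurrentTails (3655); B1′ is EASIER for fast particles (long flights in units of ε).
- Literature.Barriers.AtomisticToContinuum.NoDensityExpansionBarrier: not met as a technique
(nothing is expanded in powers of the density; σ³ is a hyperbolicity parameter and a defect size);
its physics (rings, long-time tails) enters only through equilibrium ring events over FINITE windows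
inside B1′ and through the integr

History (route lifecycle, newest last):
- 2026-08-15T13:45:04Z · CLOSED retired — not-a-thesis: assembly does not conclude the sub-problem Statement (operator:999:1257524)

sub-problem: HydrodynamicLimit · status: closed(retired) · opened planner-plancard-AtomisticToContinuum-Hydrody-061c62f0-0 2026-08-15T11:35:06Z · rev 1 · ledger route-AtomisticToContinuum-OneFlightGossip
GENERATED by the gate from the ledger (D-0016/17). Provers cite these decls: `theorem foo : Summit.AtomisticToContinuum.HydrodynamicLimit.Theses.OneFlightGossip.<Decl> := …` in Summits/AtomisticToContinuum/HydrodynamicLimit/Theorems/<Name>.lean.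
-/

namespace Summit.AtomisticToContinuum.HydrodynamicLimit.Theses.OneFlightGossip

open scoped BigOperators Topology Manifold Classical MeasureTheory ProbabilityTheory Matrix InnerProductSpace ComplexConjugate ContinuousMap
open Filter Set Function TopologicalSpace MeasureTheory

attribute [summit_statement] _root_.HydrodynamicLimit

/-- item stmt-AtomisticToContinuum-0766 · target · rank 0 · open · by planner
why it might fail: entropy production ≥ cN before the first shock for some smooth data would close every entropy route; OVY prove it only with noise and a modified kinetic energy.
sources: Yau1991, OllaVaradhanYau1993, Varadhan1993EntropyMethods
[target] X_RE: for all continuous profiles ∃ σ₀ ∀ σ<σ₀ ∀ classical hs-Euler solutions on [0,T) ∀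
flows: the initial local Gibbs laws are probability measures and, if their fields converge at t=0,
then ∀ t<T ∃ activity profile a_t such that the reference local Gibbs law (a_t, u_t, θ_t) is a
probability measure whose empirical density/momentum/energy fields concentrate exponentially (≤ C
e^{-(N+1)/C}) around (ρ,ρu,E)(t), and klDiv(lawAt Φ_N (localGibbs a₀u₀θ₀) t ‖ localGibbs a_t u_t
θ_t)/(N+1) → 0. Yau1991; OllaVaradhanYau1993 Thm 1.1 (with noise). -/
@[route_item "route-AtomisticToContinuum-OneFlightGossip"]
def RelEntropyVanishing : Prop :=
  ∀ (a₀ θ₀ : Literature.MathematicalPhysics.KineticTheory.T3 → ℝ) (u₀ : Literature.MathematicalPhysics.KineticTheory.T3 → Literature.MathematicalPhysics.KineticTheory.V3), Continuous a₀ → Continuous θ₀ → Continuous u₀ → (∀ x, 0 < a₀ x) → (∀ x, 0 < θ₀ x) → ∃ σ₀ : ℝ, 0 < σ₀ ∧ ∀ σ : ℝ, 0 < σ → σ < σ₀ → ∀ (T : ℝ) (ρ θ : ℝ → Literature.MathematicalPhysics.KineticTheory.T3 → ℝ) (u : ℝ → Literature.MathematicalPhysics.KineticTheory.T3 → Literature.MathematicalPhysics.KineticTheory.V3),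 Literature.MathematicalPhysics.KineticTheory.IsHardSphereEulerSolution σ T ρ u θ → ∀ Φ : (N : ℕ) → Literature.Analysis.FluidPDE.HardSphereFlow (Literature.Analysis.FluidPDE.Torus.geometry (Fin 3)) (Literature.MathematicalPhysics.KineticTheory.hsDiameter σ N) (N + 1), (∀ N, MeasureTheory.IsProbabilityMeasure (Literature.MathematicalPhysics.KineticTheory.localGibbsLaw σ a₀ u₀ θ₀ N (Φ N))) ∧ (Literature.MathematicalPhysics.KineticTheory.TendstoHydroFieldsAt (fun N => Literature.MathematicalPhysics.KineticTheory.localGibbsLaw σ a₀ u₀ θ₀ N (Φ N)) Φ ρ u θ 0 → ∀ t ∈ Set.Ico 0 T, ∃ a : Literature.MathematicalPhysics.KineticTheory.T3 → ℝ, (∀ N, MeasureTheory.IsProbabilityMeasure (Literature.MathematicalPhysics.KineticTheory.localGibbsLaw σ a (u t) (θ t) N (Φ N))) ∧ (∀ χ : Literature.MathematicalPhysics.KineticTheory.T3 → ℝ, Continuous χ → ∀ δ : ℝ, 0 < δ → ∃ C : ℝ, 0 < C ∧ ∀ N : ℕ, Literature.MathematicalPhysics.KineticTheory.localGibbsLaw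 σ a (u t) (θ t) N (Φ N) {z | δ < |Literature.MathematicalPhysics.KineticTheory.empiricalDensityField z χ - ∫ x, χ x * ρ t x|} ≤ ENNReal.ofReal (C * Real.exp (-(C⁻¹ * (N + 1)))) ∧ Literature.MathematicalPhysics.KineticTheory.localGibbsLaw σ a (u t) (θ t) N (Φ N) {z | δ < ‖Literature.MathematicalPhysics.KineticTheory.empiricalMomentumField z χ - ∫ x, (χ x * ρ t x) • u t x‖} ≤ ENNReal.ofReal (C * Real.exp (-(C⁻¹ * (N + 1)))) ∧ Literature.MathematicalPhysics.KineticTheory.localGibbsLaw σ a (u t) (θ t) N (Φ N) {z | δ < |Literature.MathematicalPhysics.KineticTheory.empiricalEnergyField z χ - ∫ x, χ x * Literature.MathematicalPhysics.KineticTheory.totalEnergyDensity (ρ t x) (u t x) (θ t x)|} ≤ ENNReal.ofReal (C * Real.exp (-(C⁻¹ * (N + 1))))) ∧ Filter.Tendsto (fun N : ℕ => InformationTheory.klDiv ((Φ N).lawAt (Literature.MathematicalPhysics.KineticTheory.localGibbsLaw σ a₀ u₀ θ₀ N (Φ N)) t) (Literature.MathematicalPhysics.KineticTheory.localGibbsLaw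 σ a (u t) (θ t) N (Φ N)) / ((N : ENNReal) + 1)) Filter.atTop (nhds 0))

-- item stmt-AtomisticToContinuum-5235 · crux · rank 2 · closed · moot by None · by planner — informal only, no Lean statement yet:
--   [crux] ONE-FLIGHT LAYERED ANGULAR CHAOS (card one-flight-standard-pairs-kac B1, corrected for
--   shadowing). Setting: N+1 spheres of diameter ε = hsDiameter σ N on 𝕋³, law = local Gibbs (first
--   case: global Gibbs, constant a₀, u₀ = 0, θ₀), 0 < σ < σ₀; mean free path ℓ ≍ ε/σ³; fix coarse scales
--   ε ≪ r ≪ ℓ (positions mod r, velocity directions mod r/ℓ, speeds, and the collision graph) and let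
--   𝒢_k be the σ-algebra of these coarse data up to the k-th collision layer of a kinetic window of m
--   mean free times. CLAIM: conditionally on 𝒢_k, the outgoing relative directions ĝ_out of the
--   collisions of layer k

/-- item stmt-AtomisticToContinuum-4794 · crux · rank 3 · closed · moot by None · by planner
why it might fail: at fixed σ the one-flight defects ((ε/r)² near-miss conditioning, r/ℓ distortion) may not decay along layers — a perturbative Cesàro floor O(σ^{3/4}) instead of 0; removing it needs an N-uniform self-improving (coupling) step unknown even for one 3-D particle beyond finite horizon.
sources: BGSSCPAM2023, ChernovDolgopyat2009, doi:10.4171/022-2/80, BalintToth2008, doi:10.1109/tit.2006.874516, Dorfman1999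
[crux] EQUILIBRIUM KINETIC SHEAR-STRESS DECORRELATION, UNIFORM IN N, AT FIXED SMALL DENSITY (card B2
made a deliverable; second-cumulant shadow of EquilibriumShearWindowLD stmt-3656). For constants a₀,
θ₀ > 0 there is σ₀ > 0 such that for 0 < σ < σ₀, every family of hard-sphere flows Φ_N (N+1 spheres
of diameter hsDiameter σ N on 𝕋³) and every continuous φ : 𝕋³ → ℝ: with λ^N = localGibbsLaw σ a₀ 0
θ₀ N Φ_N (canonical Gibbs, flow-invariant), w_N = τ(N+1)^{-1/3} (τ mean-free-time units) and Ȳ_τ(z)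
= (N+1)⁻¹ Σ_i w_N⁻¹ ∫₀^{w_N} φ(x_i(r)) v_i¹(r) v_i²(r) dr along Φ_N.flow r z: lim_{τ→∞} limsup_{N→∞}
(N+1)·E_{λ^N}[Ȳ_τ²] = 0. Equivalently the per-particle time-autocorrelation of the φ-weighted
kinetic shear stress is Cesàro-null on kinetic time scales uniformly in N ("no O(1) elastic memory
at Euler scaling"); hydrodynamic fluctuation theory predicts (N+1)E[Ȳ_τ²] ≍ θ₀²⟨φ²⟩(c₁ + c₂ log τ)/τ
(long-time tails are integrable in d=3). Engine: B1′ ⇒ kicks conditionally isotropic ⇒ E[stress(t) |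
coarse 𝒢₀] = traceless stress of gossip-averaged velocities + defects (GossipStressIdentity pathwise
form) ⇒ Cov(stress(0), stress(t)) ≤ E|T(0)|·(‖gossip average‖² + Σ defects), gossip averages small
by -/
@[route_item "route-AtomisticToContinuum-OneFlightGossip"]
def EquilibriumStressVarianceDecay : Prop :=
  ∀ (a₀ θ₀ : ℝ), 0 < a₀ → 0 < θ₀ → ∃ σ₀ : ℝ, 0 < σ₀ ∧ ∀ σ : ℝ, 0 < σ → σ < σ₀ → ∀ Φ : (N : ℕ) → Literature.Analysis.FluidPDE.HardSphereFlow (Literature.Analysis.FluidPDE.Torus.geometry (Fin 3)) (Literature.MathematicalPhysics.KineticTheory.hsDiameter σ N) (N + 1), ∀ φ : Literature.MathematicalPhysics.KineticTheory.T3 → ℝ, Continuous φ → Filter.Tendsto (fun τ : ℝ => Filter.limsup (fun N : ℕ => ((N : ENNReal) + 1) * ∫⁻ z, ENNReal.ofReal ((((N : ℝ) + 1)⁻¹ * ∑ i : Fin (N + 1), (τ * ((N : ℝ) + 1) ^ (-(1 / 3 : ℝ)))⁻¹ * ∫ r in (0 : ℝ)..(τ * ((N : ℝ) + 1) ^ (-(1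 / 3 : ℝ))), φ ((Φ N).flow r z i).1 * (((Φ N).flow r z i).2 0 * ((Φ N).flow r z i).2 1)) ^ 2) ∂(Literature.MathematicalPhysics.KineticTheory.localGibbsLaw σ (fun _ => a₀) (fun _ => 0) (fun _ => θ₀) N (Φ N))) Filter.atTop) Filter.atTop (nhds 0)

/-- item stmt-AtomisticToContinuum-4795 · crux · rank 4 · closed · moot by None · by planner
why it might fail: cubic observable: the damped gossip needs factorisation of cubic CROSS moments of colliding partners (partner-selection half of chaos, not supplied by angles) and velocity tails; persistence gives only 2/3 per collision and late-arriving mass escapes damping on non-round schedules.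
sources: doi:10.1512/iumj.1956.5.55001, doi:10.1007/bf02392695, doi:10.1137/070695423, doi:10.1142/s0218202515500256, Lutsko1996, BGSSCPAM2023
[crux] EQUILIBRIUM KINETIC HEAT-FLUX DECORRELATION, UNIFORM IN N (card B2, cubic moment). Same
setting as EquilibriumStressVarianceDecay with the FAST part of the kinetic energy current, F(x,v) =
φ(x)(v¹|v|² − 5θ₀v¹) (v¹|v|² minus its L²(M_{0,θ₀}) projection 5θ₀v¹ onto the collision invariant
v¹; mean zero and orthogonal to 1, v, |v|² under the centred Maxwellian): lim_{τ→∞} limsup_N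
(N+1)·E_{λ^N}[Ȳ_τ²] = 0. Engine: on ring-sparse (tree) schedules with independent mean-zero inputs
the per-particle expected heat-flux vector follows the 2/3-DAMPED gossip q ↦ (2/3)·A_{ij}q
(KacPairHeatFlux + induction), so ‖q‖₁ contracts by (2/3)^m over m rounds in which every particle
collides; at equilibrium partner velocities are independent at time 0 and ring collisions are
O(σ³)-rare per flight. [deps: KacPairHeatFlux, EquilibriumStressVarianceDecay] [difficulty:
open-problem] -/
@[route_item "route-AtomisticToContinuum-OneFlightGossip"]
def EquilibriumHeatFluxVarianceDecay : Prop :=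
  ∀ (a₀ θ₀ : ℝ), 0 < a₀ → 0 < θ₀ → ∃ σ₀ : ℝ, 0 < σ₀ ∧ ∀ σ : ℝ, 0 < σ → σ < σ₀ → ∀ Φ : (N : ℕ) → Literature.Analysis.FluidPDE.HardSphereFlow (Literature.Analysis.FluidPDE.Torus.geometry (Fin 3)) (Literature.MathematicalPhysics.KineticTheory.hsDiameter σ N) (N + 1), ∀ φ : Literature.MathematicalPhysics.KineticTheory.T3 → ℝ, Continuous φ → Filter.Tendsto (fun τ : ℝ => Filter.limsup (fun N : ℕ => ((N : ENNReal) + 1) * ∫⁻ z, ENNReal.ofReal ((((N : ℝ) + 1)⁻¹ * ∑ i : Fin (N + 1), (τ * ((N : ℝ) + 1) ^ (-(1 / 3 : ℝ)))⁻¹ * ∫ r in (0 : ℝ)..(τ * ((N : ℝ) + 1) ^ (-(1 / 3 : ℝ))), φ ((Φ N).flow r z i).1 * (((Φ N).flow r z i).2 0 * ‖((Φ N).flow r z i).2‖ ^ 2 - 5 * θ₀ * ((Φ N).flow r z i).2 0)) ^ 2) ∂(Literature.MathematicalPhysics.KineticTheory.localGibbsLaw σ (fun _ => a₀) (fun _ =>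 0) (fun _ => θ₀) N (Φ N))) Filter.atTop) Filter.atTop (nhds 0)

/-- item stmt-AtomisticToContinuum-3656 · support · rank 9 · closed · moot by None · by planner
sources: BGSSCPAM2023, BodineauEtAl2024, LeBihan2022, OllaVaradhanYau1993
[support] THE CHEAPEST TYPED SPECIAL CASE (card: "stake out first"): KineticWindowLD for GLOBAL
Gibbs data (constant activity a₀ > 0, u₀ = 0, constant temperature θ₀ > 0) and the kinetic SHEAR
stress F(x,v) = φ(x)·v¹v² (continuous φ; automatically orthogonal to 1, v, |v|² under the centred
Maxwellian). Here the reference law is flow-INVARIANT (canonical Gibbs), so Λ_{2τ} ≤ Λ_τ by Hölder,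
the long-finite-time equilibrium technology (BGSSCPAM2023, BodineauEtAl2024, LeBihan2022) applies
verbatim in time, and only the passage Boltzmann–Grad → fixed small σ³ over a FINITE window is new.
First theorem to aim at; its negation kills the whole line. [difficulty: open-problem] -/
@[route_item "route-AtomisticToContinuum-OneFlightGossip"]
def EquilibriumShearWindowLD : Prop :=
  ∀ (a₀ θ₀ : ℝ), 0 < a₀ → 0 < θ₀ → ∃ σ₀ : ℝ, 0 < σ₀ ∧ ∀ σ : ℝ, 0 < σ → σ < σ₀ → ∀ Φ : (N : ℕ) → Literature.Analysis.FluidPDE.HardSphereFlow (Literature.Analysis.FluidPDE.Torus.geometry (Fin 3)) (Literature.MathematicalPhysics.KineticTheory.hsDiameter σ N) (N + 1), ∀ φ : Literature.MathematicalPhysics.KineticTheory.T3 → ℝ, Continuous φ → ∃ β₀ : ℝ, 0 < β₀ ∧ ∀ β : ℝ, |β| ≤ β₀ → ∀ ε : ℝ, 0 < ε → ∃ τ : ℝ, 0 < τ ∧ ∃ N₀ : ℕ, ∀ N : ℕ, N₀ ≤ N → ∫⁻ z, ENNReal.ofReal (Real.exp (β * ∑ i : Fin (N + 1), (τ * ((N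 : ℝ) + 1) ^ (-(1 / 3 : ℝ)))⁻¹ * ∫ r in (0 : ℝ)..(τ * ((N : ℝ) + 1) ^ (-(1 / 3 : ℝ))), φ ((Φ N).flow r z i).1 * (((Φ N).flow r z i).2 0 * ((Φ N).flow r z i).2 1))) ∂(Literature.MathematicalPhysics.KineticTheory.localGibbsLaw σ (fun _ => a₀) (fun _ => 0) (fun _ => θ₀) N (Φ N)) ≤ ENNReal.ofReal (Real.exp (ε * ((N : ℝ) + 1)))

/-- item stmt-AtomisticToContinuum-4796 · support · rank 9 · closed · moot by None · by planner
sources: doi:10.1109/tit.2006.874516, doi:10.1007/bf02392695, ChernovDolgopyat2009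
[support] EXACT GOSSIP CLOSURE OF TRACELESS SECOND MOMENTS (card B2, exogenous schedule; provable
now). For n velocities c : Fin n → ℝ³, a schedule s : Fin m → Fin n × Fin n of pairs (i_t ≠ j_t) and
independent kicks ω_t ∼ ν_t with ν_t probability measures on ℝ³ carried by the unit sphere, mean
zero and isotropic second moments (∫⟪ω,e⟫² dν_t = |e|²/3): running the Kac/hard-sphere kinematics c
↦ (c_i, c_j ← ½(c_i+c_j) ± ½|c_i−c_j| ω_t) along s, the expectation of Σ_k (⟪c_k,e⟫² − |c_k|²|e|²/3)
after the schedule equals the same traceless quadratic form evaluated at the GOSSIP-averaged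
velocities (c_i, c_j ← ½(c_i+c_j) along s, no kicks), for every e. One step: ∫[⟪V±hω,e⟫² −
|V±hω|²|e|²/3]dν = ⟪V,e⟫² − |V|²|e|²/3; then induction over the fold + Fubini on Measure.pi.
Consequence used by the cruxes: T_after = Σ_k ((Wc)_k)^{⊗2}° with W the product of averaging
matrices, and Σ_k W_{ka}² = meeting probability of two schedule-driven lazy walkers from a
(coalescing-dual bound: ≤ 2^{−#collisions of the host} + P(hosts re-collide)). [difficulty:
provable-now] -/
@[route_item "route-AtomisticToContinuum-OneFlightGossip"]
def GossipStressIdentity : Prop :=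
  ∀ (n m : ℕ) (s : Fin m → Fin n × Fin n), (∀ t, (s t).1 ≠ (s t).2) → ∀ ν : Fin m → MeasureTheory.Measure Literature.MathematicalPhysics.KineticTheory.V3, (∀ t, MeasureTheory.IsProbabilityMeasure (ν t)) → (∀ t, ∀ᵐ ω ∂(ν t), ‖ω‖ = 1) → (∀ t, ∫ ω, ω ∂(ν t) = 0) → (∀ t (e : Literature.MathematicalPhysics.KineticTheory.V3), ∫ ω, (inner ℝ ω e) ^ 2 ∂(ν t) = ‖e‖ ^ 2 / 3) → ∀ (c : Fin n → Literature.MathematicalPhysics.KineticTheory.V3) (e : Literature.MathematicalPhysics.KineticTheory.V3), ∫ ωs, (∑ k, ((inner ℝ ((List.finRange m).foldl (fun c t => fun k => if k = (s t).1 then (1 / 2 : ℝ) • (c (s t).1 + c (s t).2) + (‖c (s t).1 - c (s t).2‖ / 2) • ωs t else if k = (s t).2 then (1 / 2 : ℝ) • (c (s t).1 + c (s t).2) - (‖c (s t).1 - c (s t).2‖ / 2) • ωs t else c k) c k) e) ^ 2 - ‖(List.finRange m).foldl (fun c t => fun k => if k = (s t).1 then (1 / 2 : ℝ) • (c (s t).1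 + c (s t).2) + (‖c (s t).1 - c (s t).2‖ / 2) • ωs t else if k = (s t).2 then (1 / 2 : ℝ) • (c (s t).1 + c (s t).2) - (‖c (s t).1 - c (s t).2‖ / 2) • ωs t else c k) c k‖ ^ 2 * ‖e‖ ^ 2 / 3)) ∂(MeasureTheory.Measure.pi ν) = ∑ k, ((inner ℝ ((List.finRange m).foldl (fun c t => fun k => if k = (s t).1 ∨ k = (s t).2 then (1 / 2 : ℝ) • (c (s t).1 + c (s t).2) else c k) c k) e) ^ 2 - ‖(List.finRange m).foldl (fun c t => fun k => if k = (s t).1 ∨ k = (s t).2 then (1 / 2 : ℝ) • (c (s t).1 + c (s t).2) else c k) c k‖ ^ 2 * ‖e‖ ^ 2 / 3)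

/-- item stmt-AtomisticToContinuum-4797 · support · rank 9 · closed · moot by None · by planner
sources: doi:10.1512/iumj.1956.5.55001, doi:10.1007/bf02392695, doi:10.1142/s0218202515500256
[support] ONE KAC COLLISION DAMPS THE PAIR HEAT FLUX BY 2/3 AND SPLITS IT EVENLY (card B2, cubic;
provable now). For independent ℝ³-valued velocities x ∼ μ, y ∼ μ′ (probability laws with finite
third moments and mean zero) and an independent kick ω ∼ ν (probability law on the unit sphere,
symmetric under ω ↦ −ω, isotropic second moments), the post-collisional velocity x′ = ½(x+y) +
½|x−y|ω satisfies E[⟪x′,e⟫|x′|²] = (E[⟪x,e⟫|x|²] + E[⟪y,e⟫|y|²])/3 for every e (and the same for y′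
= ½(x+y) − ½|x−y|ω by symmetry of ν). Proof: E_ω[⟪V+hω,e⟫|V+hω|²] = ⟪V,e⟫(|V|² + (5/3)h²) (odd
moments of ω vanish, E⟪ω,e⟫⟪ω,V⟫ = ⟪e,V⟫/3), then E⟪V,e⟫|V|² = E⟪V,e⟫h² = (q_x+q_y)/8 by
independence and zero means. Iterated along a tree schedule this is the (2/3)-damped gossip of
EquilibriumHeatFluxVarianceDecay. [difficulty: provable-now] -/
@[route_item "route-AtomisticToContinuum-OneFlightGossip"]
def KacPairHeatFlux : Prop :=
  ∀ (μ μ' ν : MeasureTheory.Measure Literature.MathematicalPhysics.KineticTheory.V3), MeasureTheory.IsProbabilityMeasure μ → MeasureTheory.IsProbabilityMeasure μ' → MeasureTheory.IsProbabilityMeasure ν → MeasureTheory.Integrable (fun x => ‖x‖ ^ 3) μ → MeasureTheory.Integrable (fun y => ‖y‖ ^ 3) μ' → ∫ x, x ∂μ = 0 → ∫ y, y ∂μ' = 0 → (∀ᵐ ω ∂ν, ‖ω‖ = 1) → ν.map (fun ω => -ω) = ν → (∀ e : Literature.MathematicalPhysics.KineticTheory.V3, ∫ ω, (inner ℝ ω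 e) ^ 2 ∂ν = ‖e‖ ^ 2 / 3) → ∀ e : Literature.MathematicalPhysics.KineticTheory.V3, ∫ x, ∫ y, ∫ ω, inner ℝ ((1 / 2 : ℝ) • (x + y) + (‖x - y‖ / 2) • ω) e * ‖(1 / 2 : ℝ) • (x + y) + (‖x - y‖ / 2) • ω‖ ^ 2 ∂ν ∂μ' ∂μ = ((∫ x, inner ℝ x e * ‖x‖ ^ 2 ∂μ) + (∫ y, inner ℝ y e * ‖y‖ ^ 2 ∂μ')) / 3

/-- item stmt-AtomisticToContinuum-0769 · assembly · rank 1 · open · by planner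
sources: Yau1991, OllaVaradhanYau1993, KipnisLandim1999
[assembly] X_RE → HydrodynamicLimit: entropy inequality μ(A) ≤ (log 2 + H(μ|λ))/log(1 + 1/λ(A))
(from Donsker–Varadhan / Mathlib klDiv API) with λ(A) ≤ C e^{-(N+1)/C} and H = o(N) gives μ(A) → 0;
μ = lawAt (Φ N) P t = P.map (flow t) turns μ{z | δ < |field z − ·|} into P{z | δ < |field (flow t z)
− ·|} (measurable_flow); the reference concentration is stated for z itself and TendstoHydroFieldsAt
at time 0 of the reference law is not needed. Zero-mass case impossible by the IsProbabilityMeasure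
clauses; take σ₀ from X_RE. -/
@[route_item "route-AtomisticToContinuum-OneFlightGossip"]
def Assembly : Prop :=
  RelEntropyVanishing → Literature.MathematicalPhysics.KineticTheory.HydrodynamicLimit

end Summit.AtomisticToContinuum.HydrodynamicLimit.Theses.OneFlightGossip
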